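import Literature.AlgebraicGeometry.Motives.JacobianFiniteIndex
import HarnessLib

/-!
# `H¹` of the Jacobian (`isIso_bettiCohomology_map_abelJacobi`): the fact assembled from its two
# open inputs

Topic `AlgebraicGeometry/Motives`; namespace `Literature.AlgebraicGeometry.Motives`. A one-theorem
bookkeeping file (fact decomposition, librarian 2026-08-16) for the named fact
`Literature.AlgebraicGeometry.Motives.isIso_bettiCohomology_map_abelJacobi` of `Jacobian.lean`
(for a smooth projective curve `C/ℂ`, a Jacobian `𝒥` of `C` in the tree's universal-property
sense and `P ∈ C(ℂ)`, pull-back along `f^P : C → J` is an isomorphism `H¹(J(ℂ); ℚ) ≅ H¹(C(ℂ); ℚ)`;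
Lange, *Abelian Varieties over the Complex Numbers* (2023), §4.1.1 and proof of Lemma 4.4.1;
Milne, *Jacobian Varieties* (1986), Thm. 2.5).

The printed proof reads the statement off the analytic description `J(ℂ) = H⁰(ω_C)^*/H₁(C, ℤ)`.
For the ABSTRACT Jacobian the tree proves (`JacobianFiniteIndex.lean`, `JacobianHomology.lean`,
covering-space theory from the universal property alone) that `(f^P)_* : H₁(C) → H₁(J)` is
injective with finite-index image, so that the fact reduces to the comparison of Betti numbers
`b₁(C) ≤ b₁(J)`, i.e. to the two named facts

* `two_mul_dim_eq_finrank_bettiCohomology` — `2 · dim J = b₁(C(ℂ))` (Milne Prop. 2.1 with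
  Thm. 2.5; Lange §4.1.1), and
* `AbelianVariety.natCard_torsionPoints_of_isAlgClosed` (for the Jacobians over `ℂ`) —
  `|A[n](ℂ)| = n^{2 dim A}` (Mumford, *Abelian Varieties*, §6 App. 3), which gives
  `b₁(J) = 2 dim J` through `π₁(J(ℂ)) ≅ H₁` and the étale covering `[n]`.

This is `isIso_bettiCohomology_map_abelJacobi_of_facts` of `JacobianFiniteIndex.lean`; the present
file only records it under the decomposition name `isIso_bettiCohomology_map_abelJacobi_holds_of`,
whose hypotheses are exactly the children of the fact. Nothing is restated; no definition, no new
named fact.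

## References

* H. Lange, *Abelian Varieties over the Complex Numbers*, Grundlehren Text Editions (2023),
  §4.1.1 and Lemma 4.4.1. [Lange2023AbelianVarietiesC]
* J. S. Milne, *Jacobian Varieties*, in Cornell–Silverman (1986), Prop. 2.1, Thm. 2.5.
  [Milne1986JacobianVarieties]
* D. Mumford, *Abelian Varieties* (1970), §6, Application 3. [MumfordAV1970]
-/

noncomputable section

open CategoryTheory AlgebraicGeometry

namespace Literature.AlgebraicGeometry.Motives

/-- **`isIso_bettiCohomology_map_abelJacobi` from its children.** The named fact
`(f^P)^* : H¹(J(ℂ); ℚ) ≅ H¹(C(ℂ); ℚ)` (Lange 2023, §4.1.1 and proof of Lemma 4.4.1) follows from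
(1) `two_mul_dim_eq_finrank_bettiCohomology` (`2 dim J = b₁(C)`, Milne Prop. 2.1) and
(2) `AbelianVariety.natCard_torsionPoints_of_isAlgClosed` for every Jacobian over `ℂ`
(`|J[n](ℂ)| = n^{2 dim J}`, Mumford §6 App. 3), everything else — finite index of
`(f^P)_* π₁(C)` in `π₁(J)` from the universal property, `H¹ = Hom(H₁, ℚ)`, `b₁(J) = 2 dim J` — being
theorems of the tree (`isIso_bettiCohomology_map_abelJacobi_of_facts`, `JacobianFiniteIndex.lean`).
[cite: Lange2023AbelianVarietiesC, §4.1.1 and Lemma 4.4.1 (proof)] -/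
theorem isIso_bettiCohomology_map_abelJacobi_holds_of
    (h₁ : two_mul_dim_eq_finrank_bettiCohomology)
    (h₂ : ∀ (C : SchemeOver ℂ) (𝒥 : Jacobian C),
      AbelianVariety.natCard_torsionPoints_of_isAlgClosed 𝒥.J ℂ) :
    isIso_bettiCohomology_map_abelJacobi :=
  isIso_bettiCohomology_map_abelJacobi_of_facts h₁ h₂

end Literature.AlgebraicGeometry.Motives

end
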